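import Summits.QuantumFields.QCD.Theorems.HeatSlicedQuarksRobustYangMillsHandoverTransferRayleighMassContinuity
import Summits.QuantumFields.QCD.Theorems.QuarksAsStableActionStableActionBridgeCoreFermionStep

/-!
# Lüscher's finite-volume transfer levels and gap are continuous in the bare masses
(crux `HeatSlicedQuarks.RobustYangMillsHandover`, item stmt-QuantumFields-8892, line `pin-the-infimum`;
helper towards the held stub `stub_spectralResponse`, mechanism step (ii) — third of three files)

For `β ≥ 0` and fixed spatial torus, the two top min–max levels `λ₀(m)`, `λ₁(m)` (`qcdTransferLevel … 0/1`) are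
continuous functions of the bare mass tuple `m` on Lüscher's range `{m | ∀ f, m_f > −1}`, and so is the gap
`qcdTransferGap … m = log λ₀(m) − log λ₁(m)` (for `N_f ≥ 1`, where `0 < λ₁ ≤ λ₀`):

* `λ₀(m) = sup {R_m(Ψ) : Ψ ∈ core, 𝔫_m(Ψ,Ψ) ≠ 0}` — the admissible set does not depend on `m`
  (`fermionWeightForm_ne_zero_iff`) and the functions `R_m` are equicontinuous in `m`
  (`transferRayleigh_mass_equicontinuous`), so the suprema are continuous;
* `λ₁(m) = inf_Φ sup {R_m(Ψ) : Ψ ∈ core, 𝔫_m(Ψ,Ψ) ≠ 0, 𝔫_m(Φ,Ψ) = 0}` — the constraint `𝔫_m(Φ,Ψ) = 0` is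
  `⟨T̂_F(m)Φ, Ψ⟩_{L²} = 0`, and `Φ ↦ T̂_F(m₂)⁻¹ T̂_F(m₁) Φ` maps core constraint waves to core constraint waves with
  `𝔫_{m₂}(Φ', ·) = 𝔫_{m₁}(Φ, ·)` (`T̂_F` Hermitian, invertible, gauge covariant: `reparam_mem_transferCore`,
  `fermionWeightForm_reparam`), so the FAMILY of constrained sets is the same for all `m` and the infima of the
  equi-close suprema are close (`qcdTransferLevel_one_sub_le`).

Main statements: `continuousOn_qcdTransferLevel_zero`, `continuousOn_qcdTransferLevel_one`,
`qcdTransferGap_continuousOn_mass` (registered sub-goal).  This is the fixed-`(k, S)` regularity in the common quark mass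
from which `stub_spectralResponse`'s barrier argument starts; it says nothing about the VOLUME-UNIFORM modulus the stub
asserts.

References: M. Reed, B. Simon, *Methods of Modern Mathematical Physics IV*, Thm XIII.1 [ReedSimonIV1978];
M. Lüscher, Commun. Math. Phys. 54 (1977) 283 [Luscher1977, pp. 283–292].  Pure theorem file.
-/

noncomputable section

namespace Summit.QuantumFields.QCD.Cruxes.RobustYangMillsHandover.PinTheInfimum

open scoped ComplexOrder ComplexConjugate Topology
open MeasureTheory Matrix Filter Literature.MathematicalPhysics.QuantumFieldTheory
  Literature.MathematicalPhysics.QuantumLattice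
open Summit.QuantumFields.QCD.Cruxes.StableActionBridge.Sketch
open Literature.MathematicalPhysics.QuantumLattice (EigenvalueContinuation.re_star_dotProduct_self_nonneg
  EigenvalueContinuation.norm_apply_sq_le)

namespace TransferMassContinuity

/-! ### Suprema and infima of families that are uniformly close -/

section SupInf

variable {α : Type*}

/-- Suprema of two functions that are `η`-close on a non-empty set (with bounded images) are `η`-close. [folklore] -/
theorem abs_sSup_image_sub_le {f g : α → ℝ} {A : Set α} (hA : A.Nonempty) (hf : BddAbove (f '' A))
    (hg : BddAbove (g '' A)) {η : ℝ} (h : ∀ x ∈ A, |f x - g x| ≤ η) :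
    |sSup (f '' A) - sSup (g '' A)| ≤ η := by
  rw [abs_sub_le_iff]
  constructor
  · rw [sub_le_iff_le_add]
    refine csSup_le (hA.image f) ?_
    rintro _ ⟨x, hx, rfl⟩
    have h1 := (abs_sub_le_iff.mp (h x hx)).1
    have h2 := le_csSup hg ⟨x, hx, rfl⟩
    linarith
  · rw [sub_le_iff_le_add]
    refine csSup_le (hA.image g) ?_
    rintro _ ⟨x, hx, rfl⟩
    have h1 := (abs_sub_le_iff.mp (h x hx)).2
    have h2 := le_csSup hf ⟨x, hx, rfl⟩
    linarith

/-- If every value of `f` on `A` is matched, up to `η`, from below by some value of `g` on `A`, then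
`inf (g '' A) ≤ inf (f '' A) + η`. [folklore] -/
theorem sInf_image_le_sInf_image_add {f g : α → ℝ} {A : Set α} (hA : A.Nonempty) (hg : BddBelow (g '' A))
    {η : ℝ} (h : ∀ x ∈ A, ∃ y ∈ A, g y ≤ f x + η) :
    sInf (g '' A) ≤ sInf (f '' A) + η := by
  rw [← sub_le_iff_le_add]
  refine le_csInf (hA.image f) ?_
  rintro _ ⟨x, hx, rfl⟩
  obtain ⟨y, hy, hyx⟩ := h x hx
  have := csInf_le hg ⟨y, hy, rfl⟩
  linarith

end SupInf

/-! ### The vacuum level `λ₀` -/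

variable {Nf S : ℕ} [NeZero S]

/-- The admissible set `{Ψ ∈ core, 𝔫_m(Ψ,Ψ) ≠ 0}` of the vacuum level does not depend on the masses. [folklore] -/
theorem trialSet_eq {m m' : Fin Nf → ℝ} (hm : ∀ f, -1 < m f) (hm' : ∀ f, -1 < m' f) :
    {Ψ : SliceWave Nf S | Ψ ∈ transferCore Nf S ∧ fermionWeightForm m Ψ Ψ ≠ 0} =
      {Ψ : SliceWave Nf S | Ψ ∈ transferCore Nf S ∧ fermionWeightForm m' Ψ Ψ ≠ 0} := by
  ext Ψ
  simp only [Set.mem_setOf_eq]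
  constructor
  · rintro ⟨hc, hn⟩
    exact ⟨hc, (fermionWeightForm_ne_zero_iff hm' hc.1).mpr ((fermionWeightForm_ne_zero_iff hm hc.1).mp hn)⟩
  · rintro ⟨hc, hn⟩
    exact ⟨hc, (fermionWeightForm_ne_zero_iff hm hc.1).mpr ((fermionWeightForm_ne_zero_iff hm' hc.1).mp hn)⟩

/-- **`λ₀` is continuous in the masses** (quantitative form): for `β ≥ 0`, `m₀` in Lüscher's range and `η > 0`, eventually
as `m → m₀` within the range, `|λ₀(m) − λ₀(m₀)| ≤ η`. [cite: ReedSimonIV1978, Thm XIII.1] -/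
theorem qcdTransferLevel_zero_sub_le {β : ℝ} (hβ : 0 ≤ β) (m₀ : {m : Fin Nf → ℝ // ∀ f, -1 < m f}) {η : ℝ}
    (hη : 0 < η) :
    ∀ᶠ m in 𝓝 m₀, |qcdTransferLevel Nf S β m.1 0 - qcdTransferLevel Nf S β m₀.1 0| ≤ η := by
  filter_upwards [transferRayleigh_mass_equicontinuous (S := S) hβ m₀ hη] with m hR
  rw [qcdTransferLevel_zero, qcdTransferLevel_zero, trialSet_eq (S := S) m.2 m₀.2]
  refine abs_sSup_image_sub_le ⟨_, TransferLevelBounds.vacuum_mem_trialSet m₀.2⟩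
    (TransferLevelOrder.bddAbove_transferRayleigh_image hβ m.2 TransferLevelBounds.continuous_of_mem_trialSet)
    (TransferLevelOrder.bddAbove_transferRayleigh_image hβ m₀.2 TransferLevelBounds.continuous_of_mem_trialSet)
    fun Ψ hΨ => hR Ψ hΨ.1.1 ((fermionWeightForm_ne_zero_iff m₀.2 hΨ.1.1).mp hΨ.2)

/-! ### Reparametrising the constraint waves of `λ₁` -/

/-- `T̂_F(U; m)` is invertible on Lüscher's range. [folklore] -/
theorem isUnit_det_fermionSliceOp (U : GaugeConfig 3 S (Matrix.specialUnitaryGroup (Fin 3) ℂ)) {m : Fin Nf → ℝ}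
    (hm : ∀ f, -1 < m f) : IsUnit (fermionSliceOp U m).det :=
  isUnit_iff_ne_zero.mpr (fermionSliceOp_posDef Nf S U m hm).det_pos.ne'

/-- `T̂_F(U; m)` is Hermitian. [folklore] -/
theorem fermionSliceOp_conjTranspose (U : GaugeConfig 3 S (Matrix.specialUnitaryGroup (Fin 3) ℂ)) {m : Fin Nf → ℝ}
    (hm : ∀ f, -1 < m f) : (fermionSliceOp U m)ᴴ = fermionSliceOp U m :=
  (fermionSliceOp_posDef Nf S U m hm).isHermitian

/-- `U ↦ T̂_F(U; m)⁻¹` is continuous on Lüscher's range (`(det)⁻¹ • adj`, the determinant never vanishes). [folklore] -/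
theorem continuous_fermionSliceOp_inv {m : Fin Nf → ℝ} (hm : ∀ f, -1 < m f) :
    Continuous fun U : GaugeConfig 3 S (Matrix.specialUnitaryGroup (Fin 3) ℂ) => (fermionSliceOp (Nf := Nf) U m)⁻¹ := by
  simp_rw [Matrix.inv_def, Ring.inverse_eq_inv]
  exact ((continuous_fermionSliceOp Nf S m hm).matrix_det.fun_inv₀ fun U =>
    (fermionSliceOp_posDef Nf S U m hm).det_pos.ne').fun_smul (continuous_fermionSliceOp Nf S m hm).matrix_adjugate

/-- Gauge covariance of the inverse: `T̂_F(U^g; m)⁻¹ = Γ(G_g) T̂_F(U; m)⁻¹ Γ(G_g)ᴴ`. [cite: Smit2023, §6.5 (6.91)] -/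
theorem fermionSliceOp_inv_gaugeTransform (g : Literature.Probability.LatticeModels.TorusSite 3 S →
      Matrix.specialUnitaryGroup (Fin 3) ℂ) (U : GaugeConfig 3 S (Matrix.specialUnitaryGroup (Fin 3) ℂ))
    {m : Fin Nf → ℝ} (hm : ∀ f, -1 < m f) :
    (fermionSliceOp (gaugeTransform g U) m)⁻¹ = fockGaugeAct g * (fermionSliceOp (Nf := Nf) U m)⁻¹ * (fockGaugeAct g)ᴴ := by
  rw [fermionSliceOp_gaugeTransform' g U m]
  refine Matrix.inv_eq_left_inv ?_
  have hU := fockGaugeAct_conjTranspose_mul_self Nf S g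
  calc fockGaugeAct g * (fermionSliceOp U m)⁻¹ * (fockGaugeAct g)ᴴ * (fockGaugeAct g * fermionSliceOp U m * (fockGaugeAct g)ᴴ)
      = fockGaugeAct g * ((fermionSliceOp U m)⁻¹ * ((fockGaugeAct g)ᴴ * fockGaugeAct g) * fermionSliceOp U m) *
          (fockGaugeAct g)ᴴ := by simp only [Matrix.mul_assoc]
    _ = 1 := by
        rw [hU.1, Matrix.mul_one, Matrix.nonsing_inv_mul _ (isUnit_det_fermionSliceOp U hm), Matrix.mul_one, hU.2]

/-- **The reparametrised constraint wave is a core wave**: for `Φ ∈ core` and `m₁, m₂` in Lüscher's range,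
`U ↦ T̂_F(U;m₂)⁻¹ T̂_F(U;m₁) Φ(U)` is continuous and gauge invariant. [folklore] -/
theorem reparam_mem_transferCore {m₁ m₂ : Fin Nf → ℝ} (hm₁ : ∀ f, -1 < m₁ f) (hm₂ : ∀ f, -1 < m₂ f)
    {Φ : SliceWave Nf S} (hΦ : Φ ∈ transferCore Nf S) :
    (fun U : GaugeConfig 3 S (Matrix.specialUnitaryGroup (Fin 3) ℂ) =>
        (fermionSliceOp U m₂)⁻¹ *ᵥ (fermionSliceOp U m₁ *ᵥ Φ U)) ∈ transferCore Nf S := by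
  have hTΦ := fermionSliceOp_mulVec_mem_transferCore Nf S m₁ hm₁ Φ hΦ
  refine ⟨(continuous_fermionSliceOp_inv hm₂).matrix_mulVec hTΦ.1, fun g U => ?_⟩
  show (fermionSliceOp (gaugeTransform g U) m₂)⁻¹ *ᵥ (fermionSliceOp (gaugeTransform g U) m₁ *ᵥ Φ (gaugeTransform g U)) =
    fockGaugeAct g *ᵥ ((fermionSliceOp U m₂)⁻¹ *ᵥ (fermionSliceOp U m₁ *ᵥ Φ U))
  have h1 : fermionSliceOp (gaugeTransform g U) m₁ *ᵥ Φ (gaugeTransform g U) =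
      fockGaugeAct g *ᵥ (fermionSliceOp U m₁ *ᵥ Φ U) := hTΦ.2 g U
  rw [h1, fermionSliceOp_inv_gaugeTransform g U hm₂, ← Matrix.mulVec_mulVec, ← Matrix.mulVec_mulVec,
    fockGaugeAct_conjTranspose_mulVec_mulVec]

/-- The pairing identity `⟨A v, w⟩ = ⟨v, Aᴴ w⟩` for `star v ⬝ᵥ w`. [folklore] -/
theorem star_mulVec_dotProduct {ι : Type*} [Fintype ι] (A : Matrix ι ι ℂ) (v w : ι → ℂ) :
    star (A *ᵥ v) ⬝ᵥ w = star v ⬝ᵥ (Aᴴ *ᵥ w) := by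
  rw [star_mulVec, ← dotProduct_mulVec]

/-- **The reparametrisation transports the constraint**: `𝔫_{m₂}(T̂_F(m₂)⁻¹T̂_F(m₁)Φ, Ψ) = 𝔫_{m₁}(Φ, Ψ)` for every `Ψ`
(pointwise `⟨T₂⁻¹T₁Φ, T₂Ψ⟩ = ⟨T₁Φ, T₂⁻¹T₂Ψ⟩ = ⟨T₁Φ, Ψ⟩ = ⟨Φ, T₁Ψ⟩`, `T̂_F` Hermitian and invertible). [folklore] -/
theorem fermionWeightForm_reparam {m₁ m₂ : Fin Nf → ℝ} (hm₁ : ∀ f, -1 < m₁ f) (hm₂ : ∀ f, -1 < m₂ f)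
    (Φ Ψ : SliceWave Nf S) :
    fermionWeightForm m₂ (fun U : GaugeConfig 3 S (Matrix.specialUnitaryGroup (Fin 3) ℂ) =>
        (fermionSliceOp U m₂)⁻¹ *ᵥ (fermionSliceOp U m₁ *ᵥ Φ U)) Ψ = fermionWeightForm m₁ Φ Ψ := by
  unfold fermionWeightForm
  refine integral_congr_ae (Eventually.of_forall fun U => ?_)
  show star ((fermionSliceOp U m₂)⁻¹ *ᵥ (fermionSliceOp U m₁ *ᵥ Φ U)) ⬝ᵥ (fermionSliceOp U m₂ *ᵥ Ψ U) =
    star (Φ U) ⬝ᵥ (fermionSliceOp U m₁ *ᵥ Ψ U)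
  rw [star_mulVec_dotProduct, Matrix.conjTranspose_nonsing_inv, fermionSliceOp_conjTranspose U hm₂,
    Matrix.mulVec_mulVec, Matrix.nonsing_inv_mul _ (isUnit_det_fermionSliceOp U hm₂), Matrix.one_mulVec,
    star_mulVec_dotProduct, fermionSliceOp_conjTranspose U hm₁]

/-- **The constrained trial sets of `λ₁` are reparametrisation-invariant**: with `Φ' = T̂_F(m₂)⁻¹T̂_F(m₁)Φ`,
`{Ψ ∈ core, 𝔫_{m₂}(Ψ,Ψ) ≠ 0, 𝔫_{m₂}(Φ', Ψ) = 0} = {Ψ ∈ core, 𝔫_{m₁}(Ψ,Ψ) ≠ 0, 𝔫_{m₁}(Φ, Ψ) = 0}`. [folklore] -/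
theorem constraintSet_reparam {m₁ m₂ : Fin Nf → ℝ} (hm₁ : ∀ f, -1 < m₁ f) (hm₂ : ∀ f, -1 < m₂ f)
    (Φ : Fin 1 → SliceWave Nf S) :
    {Ψ : SliceWave Nf S | Ψ ∈ transferCore Nf S ∧ fermionWeightForm m₂ Ψ Ψ ≠ 0 ∧
        ∀ i, fermionWeightForm m₂ (fun U : GaugeConfig 3 S (Matrix.specialUnitaryGroup (Fin 3) ℂ) =>
          (fermionSliceOp U m₂)⁻¹ *ᵥ (fermionSliceOp U m₁ *ᵥ Φ i U)) Ψ = 0} =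
      {Ψ : SliceWave Nf S | Ψ ∈ transferCore Nf S ∧ fermionWeightForm m₁ Ψ Ψ ≠ 0 ∧
        ∀ i, fermionWeightForm m₁ (Φ i) Ψ = 0} := by
  ext Ψ
  simp only [Set.mem_setOf_eq, fermionWeightForm_reparam hm₁ hm₂]
  constructor
  · rintro ⟨hc, hn, hC⟩
    exact ⟨hc, (fermionWeightForm_ne_zero_iff hm₁ hc.1).mpr ((fermionWeightForm_ne_zero_iff hm₂ hc.1).mp hn), hC⟩
  · rintro ⟨hc, hn, hC⟩
    exact ⟨hc, (fermionWeightForm_ne_zero_iff hm₂ hc.1).mpr ((fermionWeightForm_ne_zero_iff hm₁ hc.1).mp hn), hC⟩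

/-- One direction of the continuity of `λ₁`: if `R_{m₂}` is `η`-above-bounded by `R_{m₁}` on continuous waves with
`∫Re⟨Ψ,Ψ⟩ ≠ 0`, then `λ₁(m₂) ≤ λ₁(m₁) + η`. [cite: ReedSimonIV1978, Thm XIII.1] -/
theorem qcdTransferLevel_one_le_add {β : ℝ} (hβ : 0 ≤ β) {m₁ m₂ : Fin Nf → ℝ} (hm₁ : ∀ f, -1 < m₁ f)
    (hm₂ : ∀ f, -1 < m₂ f) {η : ℝ} (hη : 0 ≤ η)
    (hR : ∀ Ψ : SliceWave Nf S, Continuous Ψ → (∫ U, (star (Ψ U) ⬝ᵥ Ψ U).re ∂(sliceHaar S)) ≠ 0 →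
      |transferRayleigh β m₂ Ψ - transferRayleigh β m₁ Ψ| ≤ η) :
    qcdTransferLevel Nf S β m₂ 1 ≤ qcdTransferLevel Nf S β m₁ 1 + η := by
  unfold qcdTransferLevel
  refine sInf_image_le_sInf_image_add (TransferLevelOrder.qcdTransferLevel_set_nonempty β m₁ 1 |>.of_image)
    (TransferLevelOrder.bddBelow_qcdTransferLevel_set hβ hm₂ 1) fun Φ hΦ => ?_
  -- the reparametrised constraint family
  refine ⟨fun i U => (fermionSliceOp U m₂)⁻¹ *ᵥ (fermionSliceOp U m₁ *ᵥ Φ i U),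
    fun i => reparam_mem_transferCore hm₁ hm₂ (hΦ i), ?_⟩
  show sSup (transferRayleigh β m₂ '' {Ψ | Ψ ∈ transferCore Nf S ∧ fermionWeightForm m₂ Ψ Ψ ≠ 0 ∧
      ∀ i, fermionWeightForm m₂ (fun U => (fermionSliceOp U m₂)⁻¹ *ᵥ (fermionSliceOp U m₁ *ᵥ Φ i U)) Ψ = 0}) ≤
    sSup (transferRayleigh β m₁ '' {Ψ | Ψ ∈ transferCore Nf S ∧ fermionWeightForm m₁ Ψ Ψ ≠ 0 ∧
      ∀ i, fermionWeightForm m₁ (Φ i) Ψ = 0}) + η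
  rw [constraintSet_reparam hm₁ hm₂ Φ]
  set C : Set (SliceWave Nf S) := {Ψ | Ψ ∈ transferCore Nf S ∧ fermionWeightForm m₁ Ψ Ψ ≠ 0 ∧
      ∀ i, fermionWeightForm m₁ (Φ i) Ψ = 0} with hC
  have hcont : ∀ Ψ ∈ C, Continuous Ψ := fun Ψ hΨ => hΨ.1.1
  rcases C.eq_empty_or_nonempty with hCe | hCne
  · rw [hCe, Set.image_empty, Set.image_empty]
    linarith
  · have h := abs_sSup_image_sub_le hCne (TransferLevelOrder.bddAbove_transferRayleigh_image hβ hm₂ hcont)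
      (TransferLevelOrder.bddAbove_transferRayleigh_image hβ hm₁ hcont)
      fun Ψ hΨ => hR Ψ hΨ.1.1 ((fermionWeightForm_ne_zero_iff hm₁ hΨ.1.1).mp hΨ.2.1)
    have h' := (abs_sub_le_iff.mp h).1
    linarith

/-- **`λ₁` is continuous in the masses** (quantitative form): for `β ≥ 0`, `m₀` in Lüscher's range and `η > 0`, eventually
as `m → m₀` within the range, `|λ₁(m) − λ₁(m₀)| ≤ η`. [cite: ReedSimonIV1978, Thm XIII.1] -/
theorem qcdTransferLevel_one_sub_le {β : ℝ} (hβ : 0 ≤ β) (m₀ : {m : Fin Nf → ℝ // ∀ f, -1 < m f}) {η : ℝ}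
    (hη : 0 < η) :
    ∀ᶠ m in 𝓝 m₀, |qcdTransferLevel Nf S β m.1 1 - qcdTransferLevel Nf S β m₀.1 1| ≤ η := by
  filter_upwards [transferRayleigh_mass_equicontinuous (S := S) hβ m₀ hη] with m hR
  rw [abs_sub_le_iff]
  constructor
  · rw [sub_le_iff_le_add']
    exact qcdTransferLevel_one_le_add (S := S) hβ m₀.2 m.2 hη.le hR
  · rw [sub_le_iff_le_add']
    refine qcdTransferLevel_one_le_add (S := S) hβ m.2 m₀.2 hη.le fun Ψ hΨ hN => ?_
    rw [abs_sub_comm]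
    exact hR Ψ hΨ hN

/-! ### Continuity statements -/

/-- From quantitative closeness to continuity on the range (as a subtype). [folklore] -/
theorem continuous_of_eventually_abs_sub_le {f : {m : Fin Nf → ℝ // ∀ f, -1 < m f} → ℝ}
    (h : ∀ (m₀ : {m : Fin Nf → ℝ // ∀ f, -1 < m f}) (η : ℝ), 0 < η → ∀ᶠ m in 𝓝 m₀, |f m - f m₀| ≤ η) :
    Continuous f := by
  refine continuous_iff_continuousAt.mpr fun m₀ => Metric.continuousAt_iff'.mpr fun ε hε => ?_
  filter_upwards [h m₀ (ε / 2) (half_pos hε)] with m hm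
  rw [Real.dist_eq]
  linarith

/-- **`λ₀` is continuous in the bare masses on Lüscher's range** (`β ≥ 0`). [cite: ReedSimonIV1978, Thm XIII.1] -/
theorem continuousOn_qcdTransferLevel_zero {β : ℝ} (hβ : 0 ≤ β) :
    ContinuousOn (fun m : Fin Nf → ℝ => qcdTransferLevel Nf S β m 0) {m | ∀ f, -1 < m f} := by
  rw [continuousOn_iff_continuous_restrict]
  exact continuous_of_eventually_abs_sub_le fun m₀ η hη => qcdTransferLevel_zero_sub_le (S := S) hβ m₀ hη

/-- **`λ₁` is continuous in the bare masses on Lüscher's range** (`β ≥ 0`). [cite: ReedSimonIV1978, Thm XIII.1] -/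
theorem continuousOn_qcdTransferLevel_one {β : ℝ} (hβ : 0 ≤ β) :
    ContinuousOn (fun m : Fin Nf → ℝ => qcdTransferLevel Nf S β m 1) {m | ∀ f, -1 < m f} := by
  rw [continuousOn_iff_continuous_restrict]
  exact continuous_of_eventually_abs_sub_le fun m₀ η hη => qcdTransferLevel_one_sub_le (S := S) hβ m₀ hη

end TransferMassContinuity

/-- **The finite-volume transfer-matrix gap of lattice QCD is a continuous function of the bare quark masses** on
Lüscher's range (registered sub-goal `qcdTransferGap_continuousOn_mass` of crux stmt-QuantumFields-8892, line
`pin-the-infimum`; mechanism step (ii) of `stub_spectralResponse` at fixed `(k, S)`): for `N_f ≥ 1`, `β ≥ 0` and every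
spatial torus, `m ↦ qcdTransferGap N_f β S m = log λ₀(m) − log λ₁(m)` is continuous on `{m | ∀ f, m_f > −1}`
(both levels are continuous and strictly positive there). [cite: ReedSimonIV1978, Thm XIII.1] [cite: Luscher1977, pp. 283–292] -/
theorem qcdTransferGap_continuousOn_mass : ∀ (Nf S : ℕ) [NeZero Nf] [NeZero S] (β : ℝ), 0 ≤ β → ContinuousOn (fun m : Fin Nf → ℝ => qcdTransferGap Nf β S m) {m | ∀ f, -1 < m f} := by
  intro Nf S _ _ β hβ
  have h0 := TransferMassContinuity.continuousOn_qcdTransferLevel_zero (Nf := Nf) (S := S) hβ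
  have h1 := TransferMassContinuity.continuousOn_qcdTransferLevel_one (Nf := Nf) (S := S) hβ
  have e : (fun m : Fin Nf → ℝ => qcdTransferGap Nf β S m) =
      fun m => Real.log (qcdTransferLevel Nf S β m 0) - Real.log (qcdTransferLevel Nf S β m 1) := rfl
  rw [e]
  exact (h0.log fun m hm => (TransferLevelBounds.qcdTransferLevel_zero_pos hβ hm).ne').sub
    (h1.log fun m hm => (qcdTransferLevel_one_pos Nf S β m hβ hm).ne')

end Summit.QuantumFields.QCD.Cruxes.RobustYangMillsHandover.PinTheInfimum

end
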